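import Literature.NumberTheory.IwasawaTheory.ClassGroupPRankLeOneOfCardFixedLeTwoLayerTwo
import Literature.NumberTheory.IwasawaTheory.ClassGroupPRankLeOneOfAmbiguousLayerTwoOddIndex
import Literature.NumberTheory.IwasawaTheory.ClassicalMuVanishesUnitNormIndex
import Literature.NumberTheory.NumberFields.QuadraticNonNormUnitDyadicIdeal
import HarnessLib

/-!
# The PRO-CYCLIC DOOR in Chevalley's currency: `2 ∤ h_K`, `4 ∣ h(K_1)`, exactly two primes of `K` ramified in `K_2` and ONE unit of `K`
# outside `N_{K_2/K} K_2ˣ` ⟹ `rank₂ Cl(K_m) ≤ 1` for every `m`, `μ₂ = 0`, `λ₂ ≤ 1`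

Topic `NumberTheory/IwasawaTheory` (namespace = path).  THEOREM-ONLY file (no definition, no named fact, no instance, no `sorry`), written by the
prover seat `bsd-line-att-p3` g46 (cell `bsd-f1-sign2`, route `AlignedTransportAtTwo`; `--supports` stmt-BirchSwinnertonDyer-22298, closes nothing; no class group
is computed here).  Sequel of `ClassGroupPRankLeOneOfCardFixedLeTwoLayerTwo.lean` (this seat: the pro-cyclic door `2 ≤ ord₂ h(K_1) ∧ 4 ∤ #Cl(K_2)^{Gal(K_2/K)}
⟹ rank ≤ 1, μ₂ = 0, λ₂ ≤ 1`), discharging its fixed-class hypothesis by CHEVALLEY's ambiguous class number formula for the cyclic QUARTIC layer `K_2/K`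
(tree `ambiguousClassNumberFormula`): `#Cl(K_2)^G · [K_2:K] · [E_K : E_K ∩ N_{K_2/K} K_2ˣ] = h_K · ∏_𝔭 e_𝔭 · e_∞` with `[K_2:K] = 4`, `∏ e_𝔭 = 4²` (two ramified primes,
each totally ramified: Fukuda index `0`), `e_∞ = 1` — so `#Cl(K_2)^G · [E_K : E_K ∩ N] = 4 h_K`, and `4 ∤ #Cl(K_2)^G` as soon as the unit index is EVEN, i.e. as soon
as ONE unit of `K` is not a norm from `K_2` (its coset in `E_K/(E_K ∩ N)` is killed by `[K_2 : K] = 4` but is not trivial).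

* `dvd_relIndex_unitsNorm_of_not_mem` — `L/K` Galois of degree `p^k`, `u ∈ E_K ∖ N_{L/K} Lˣ` ⟹ `p ∣ [E_K : E_K ∩ N Lˣ]` (`u^{[L:K]} = N(u)`,
  tree `pow_finrank_mem_map_norm`).
* ★★ `classGroupPRank_le_one_of_two_le_of_not_four_dvd`, `classicalMuVanishes_and_classicalLambda_le_one_of_two_le_of_not_four_dvd` — the companion's one-layer
  door (`rank₂ Cl(K_2) ≤ 1 < 2² − 1`) pushed to EVERY layer by the small-rank criterion L10 (tree `classGroupPRank_le_of_lt_pow_sub_one`) and to `μ₂ = 0`, `λ₂ ≤ 1`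
  (tree `classicalLambda_le_of_forall_classGroupPRank_le`).
* ★★ `not_four_dvd_card_fixed_layer_two_of_not_mem` — `TotallyRamifiedFrom κ 0`, `2 ∤ h_K`, EXACTLY two primes of `K` ramified in `K_2`, a unit of `K` outside
  `N_{K_2/K} K_2ˣ` ⟹ `4 ∤ #Cl(K_2)^{Gal(K_2/K)}`.
* ★★★ `classGroupPRank_le_one_of_two_le_of_not_mem` — THE PRO-CYCLIC DOOR IN CHEVALLEY'S CURRENCY: moreover `2 ≤ ord₂ h(K_1)` ⟹ `rank₂ Cl(K_m) ≤ 1 ∀ m`,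
  `μ₂(κ) = 0`, `λ₂(κ) ≤ 1`.
* ★★★ `…_of_forall_odd_ramificationIdx`, `…_of_not_dvd_discr` — the same for an ODD-DEGREE `K` whose dyadic primes have odd `e(w|2)` (e.g. `2 ∤ d_K`) with EXACTLY
  TWO primes above `2`, `κ` cyclotomic, and the non-norm unit given as `ε ∈ (𝓞 K)ˣ`: Fukuda's index is `0` and exactly the two dyadic primes ramify in `K_2`
  (tree `totallyRamifiedFrom_zero_of_forall_odd_ramificationIdx`, `ncard_dyadic_le_ncard_ramified_layer`, `ncard_ramified_layer_le_of_ncard_eq`).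

USE (cell bsd-f1-sign2, crux C2; complex cubic `F = ℚ(β)`, `h_F` odd, `Δ_W ≡ 5 (8)`, `2 = 𝔭₁𝔭₂`): the remaining displayed data are `4 ∣ h(F(√2))` (one class-number bit)
and `ε_F ∉ N_{F_2/F} F_2ˣ` — the latter holds exactly when `σ₁(ε_F) ≢ ±1 (mod 16)` at the degree-one dyadic prime (the norm group of `ℚ₂(ζ₁₆)⁺/ℚ₂` on units is
`±1 + 16ℤ₂`; O'Meara §63 / local class field theory), i.e. on the cell's class `t ≤ 3`; with `t = 3` forced by `4 ∣ h(F_1)` failing Chevalley's `t = 2` door.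
HONEST SCOPE: classical (Chevalley–Lang genus theory + the companion file); nothing specific to any summit; BSD is not advanced by this file.

References: [Lang1990] Ch. 13 §4 Lemma 4.1–4.2 (PDF pp. 203–204); [Gras2003] II.6.2.3, IV.4; [Washington1997] §13.1 Prop. 13.2, §13.3 Prop. 13.22–13.23;
[Fukuda1994] Thm. 1 (2), p. 264; [NeukirchANT1999] Ch. III (2.12); [Omeara1963] §63B.
-/

set_option autoImplicit false

noncomputable section

open scoped NumberField
open NumberField IsDedekindDomain Field IntermediateField

namespace Literature.NumberTheory.IwasawaTheory

open Literature.NumberTheory.EllipticCurves Literature.NumberTheory.NumberFields Literature.NumberTheory.NumberFields.AmbiguousClass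
  Literature.NumberTheory.GaloisRepresentations Literature.NumberTheory.GaloisRepresentations.Herbrand
  Literature.NumberTheory.GaloisRepresentations.MinkowskiUnit Literature.NumberTheory.GaloisRepresentations.CyclicNormIndex

/-! ## §1 A non-norm unit makes the unit index divisible by `p` (degree `p^k`) -/

section Index

variable {K L : Type} [Field K] [NumberField K] [Field L] [NumberField L] [Algebra K L]

/-- **`p ∣ [E_K : E_K ∩ N_{L/K} Lˣ]` as soon as ONE unit of `K` is not a norm from `L`** (`L/K` Galois of degree `p^k`): the coset of that unit in
`E_K/(E_K ∩ N Lˣ)` is non-trivial and killed by `p^k`, since `u^{[L:K]} = N_{L/K}(u)` (tree `pow_finrank_mem_map_norm`).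
[cite: Lang1990, Ch. 13 §4, Lemma 4.1 and proof of Lemma 4.2 (PDF pp. 203–204)] -/
theorem dvd_relIndex_unitsNorm_of_not_mem [IsGalois K L] {p k : ℕ} (hp : p.Prime) (hdeg : Module.finrank K L = p ^ k) {u : Lˣ}
    (hu : u ∈ unitsE L ⊓ (unitsIncl K L).range) (hnot : u ∉ (⊤ : Subgroup Lˣ).map (Herbrand.norm (L ≃ₐ[K] L))) :
    p ∣ (unitsE L ⊓ (⊤ : Subgroup Lˣ).map (Herbrand.norm (L ≃ₐ[K] L))).relIndex (unitsE L ⊓ (unitsIncl K L).range) := by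
  classical
  haveI : Fact p.Prime := ⟨hp⟩
  set H := unitsE L ⊓ (⊤ : Subgroup Lˣ).map (Herbrand.norm (L ≃ₐ[K] L)) with hH
  set E := unitsE L ⊓ (unitsIncl K L).range with hE
  have hpowH : u ^ p ^ k ∈ H := by
    rw [← hdeg]; exact ⟨(unitsE L).pow_mem hu.1 _, pow_finrank_mem_map_norm hu.2⟩
  set q : E ⧸ H.subgroupOf E := QuotientGroup.mk ⟨u, hu⟩ with hq
  have hq1 : q ≠ 1 := by
    intro h1
    rw [hq, QuotientGroup.eq_one_iff, Subgroup.mem_subgroupOf] at h1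
    exact hnot h1.2
  have hqp : q ^ p ^ k = 1 := by
    rw [hq, ← QuotientGroup.mk_pow, QuotientGroup.eq_one_iff, Subgroup.mem_subgroupOf]
    exact hpowH
  obtain ⟨j, -, hj⟩ := (Nat.dvd_prime_pow hp).mp (orderOf_dvd_of_pow_eq_one hqp)
  have hj0 : j ≠ 0 := by
    rintro rfl
    rw [pow_zero, orderOf_eq_one_iff] at hj
    exact hq1 hj
  have hpq : p ∣ orderOf q := by rw [hj]; exact dvd_pow_self p hj0
  rw [Subgroup.relIndex, Subgroup.index]
  exact hpq.trans (orderOf_dvd_natCard q)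

end Index

/-! ## §2 Chevalley's count for `K_2/K`: `4 ∤ #Cl(K_2)^G` from a non-norm unit -/

section Chevalley

variable {K : Type} [Field K] [NumberField K]

/-- ★★ **THE PRO-CYCLIC DOOR (every layer).**  Under the hypotheses of `classGroupPRank_two_le_one_of_two_le_of_not_four_dvd`:
**`rank₂ Cl(K_m) ≤ 1` for every `m`** (`rank₂ Cl(K_2) ≤ 1 < 2² − 1` is the one-layer small-rank criterion L10 at `j = 2`, tree
`classGroupPRank_le_of_lt_pow_sub_one`). [cite: Washington1997, §13.3 Prop. 13.22–13.23] [cite: Fukuda1994, Thm. 1 (2), p. 264] -/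
theorem classGroupPRank_le_one_of_two_le_of_not_four_dvd (κ : ZpExtension K 2) (hκ : TotallyRamifiedFrom κ 0)
    (hK : ¬ 2 ∣ classNumber K) (he1 : 2 ≤ classNumberPExp κ 1)
    (hfix : ¬ 4 ∣ Nat.card {c : ClassGroup (𝓞 (κ.layer 2)) //
        ∀ τ : (κ.layer 2) ≃ₐ[K] (κ.layer 2), ClassGroup.mulEquiv (AmbiguousClass.intAut τ) c = c}) (m : ℕ) :
    classGroupPRank κ m ≤ 1 := by
  have h2 := classGroupPRank_two_le_one_of_two_le_of_not_four_dvd κ hκ hK he1 hfix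
  have hsmall : classGroupPRank κ (0 + 2) < 2 ^ 2 - 1 := by
    rw [Nat.zero_add]
    have : (2 : ℕ) ^ 2 - 1 = 3 := by norm_num
    omega
  have h := classGroupPRank_le_of_lt_pow_sub_one κ hκ le_rfl hsmall m
  rw [Nat.zero_add, Nat.zero_add] at h
  exact h.trans h2

/-- ★★ **THE PRO-CYCLIC DOOR: `μ₂ = 0` and `λ₂ ≤ 1`.**  Under the hypotheses of `classGroupPRank_two_le_one_of_two_le_of_not_four_dvd` the `2`-ranks are
bounded by `1` along the whole tower, so Iwasawa's `μ`-invariant of `κ` vanishes (growth form) and `λ(κ) ≤ 1` (tree `classicalLambda_le_of_forall_classGroupPRank_le`).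
[cite: Washington1997, §13.3 Prop. 13.23 and Thm. 13.13] [cite: Fukuda1994, Thm. 1 (2), p. 264] -/
theorem classicalMuVanishes_and_classicalLambda_le_one_of_two_le_of_not_four_dvd (κ : ZpExtension K 2)
    (hκ : TotallyRamifiedFrom κ 0) (hK : ¬ 2 ∣ classNumber K) (he1 : 2 ≤ classNumberPExp κ 1)
    (hfix : ¬ 4 ∣ Nat.card {c : ClassGroup (𝓞 (κ.layer 2)) //
        ∀ τ : (κ.layer 2) ≃ₐ[K] (κ.layer 2), ClassGroup.mulEquiv (AmbiguousClass.intAut τ) c = c}) :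
    ClassicalMuVanishes κ ∧ classicalLambda κ ≤ 1 :=
  classicalLambda_le_of_forall_classGroupPRank_le κ hκ le_rfl (B := 1) fun m _ =>
    classGroupPRank_le_one_of_two_le_of_not_four_dvd κ hκ hK he1 hfix m

/-- ★★ **`4 ∤ #Cl(K_2)^{Gal(K_2/K)}` for a `ℤ₂`-extension with Fukuda index `0` over a base with `2 ∤ h_K`, EXACTLY two primes of `K` ramified in `K_2`, and a
unit of `K` outside `N_{K_2/K} K_2ˣ`**: `#Cl(K_2)^G · 4 · [E_K : E_K ∩ N] = h_K · 4²` (tree `ambiguousClassNumberFormula`, `∏ e_𝔭 = 4²` by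
`finprod_ramificationIdxIn_layer_eq_pow`, `e_∞ = 1`) with the unit index even (§1). [cite: Lang1990, Ch. 13 §4, Lemma 4.1 (PDF pp. 203–204)] [cite: Gras2003, II.6.2.3]
[cite: Washington1997, §13.1 Prop. 13.2] -/
theorem not_four_dvd_card_fixed_layer_two_of_not_mem (κ : ZpExtension K 2) (hκ : TotallyRamifiedFrom κ 0) (hK : ¬ 2 ∣ classNumber K)
    [NumberField (κ.layer 2)]
    (hs : {v : HeightOneSpectrum (𝓞 K) | v.asIdeal.ramificationIdxIn (𝓞 (κ.layer 2)) ≠ 1}.ncard = 2)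
    {u : (κ.layer 2)ˣ} (hu : u ∈ unitsE (κ.layer 2) ⊓ (unitsIncl K (κ.layer 2)).range)
    (hnot : u ∉ (⊤ : Subgroup (κ.layer 2)ˣ).map (Herbrand.norm ((κ.layer 2) ≃ₐ[K] (κ.layer 2)))) :
    ¬ 4 ∣ Nat.card {c : ClassGroup (𝓞 (κ.layer 2)) //
      ∀ τ : (κ.layer 2) ≃ₐ[K] (κ.layer 2), ClassGroup.mulEquiv (intAut τ) c = c} := by
  classical
  haveI : Fact (Nat.Prime 2) := ⟨Nat.prime_two⟩
  haveI : FiniteDimensional K (κ.layer 2) := κ.finiteDimensional_layer_holds 2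
  haveI : IsGalois K (κ.layer 2) := κ.isGalois_layer_holds 2
  haveI : IsUnramifiedAtInfinitePlaces K (κ.layer 2) := κ.isUnramifiedAtInfinitePlaces_layer 2
  -- `Gal(K_2/K)` is cyclic
  obtain ⟨ψ, -, hker, -⟩ := κ.exists_cyclicCharacter_layer 2
  haveI : IsCyclic ((κ.layer 2) ≃ₐ[K] (κ.layer 2)) := isCyclic_of_cyclicLayer ψ (κ.layer 2) hker
  obtain ⟨σ, hσ⟩ := IsCyclic.exists_generator (α := (κ.layer 2) ≃ₐ[K] (κ.layer 2))
  have h := ambiguousClassNumberFormula hσ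
  rw [κ.finrank_layer_holds 2, archFactor_eq_one, mul_one, finprod_ramificationIdxIn_layer_eq_pow κ hκ 2, hs] at h
  -- h : #fix * 2^2 * idx = h_K * (2^2)^2
  have hdeg : Module.finrank K (κ.layer 2) = 2 ^ 2 := κ.finrank_layer_holds 2
  obtain ⟨b, hb⟩ := dvd_relIndex_unitsNorm_of_not_mem Nat.prime_two hdeg hu hnot
  rintro ⟨a, ha⟩
  rw [ha, hb] at h
  apply hK
  refine ⟨a * b, Nat.eq_of_mul_eq_mul_right (by norm_num : 0 < 16) ?_⟩
  have h' : classNumber K * 16 = 4 * a * 2 ^ 2 * (2 * b) := by rw [h]; norm_num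
  rw [h']; ring

/-- ★★★ **THE PRO-CYCLIC DOOR IN CHEVALLEY'S CURRENCY (Fukuda index `0`).**  `κ` a `ℤ₂`-extension of the number field `K`, totally ramified at every ramified prime from
`K` itself, with `2 ∤ h_K`, **`2 ≤ ord₂ h(K_1)`**, EXACTLY two primes of `K` ramified in `K_2`, and ONE unit of `K` outside `N_{K_2/K} K_2ˣ`.  THEN **`rank₂ Cl(K_m) ≤ 1`
for every `m`, `μ₂(κ) = 0` and `λ₂(κ) ≤ 1`** (companion door `classGroupPRank_le_one_of_two_le_of_not_four_dvd` + the count above).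
[cite: Washington1997, §13.3 Prop. 13.22–13.23] [cite: Lang1990, Ch. 13 §4, Lemma 4.1 (PDF pp. 203–204)] [cite: Fukuda1994, Thm. 1 (2), p. 264] -/
theorem classGroupPRank_le_one_of_two_le_of_not_mem (κ : ZpExtension K 2) (hκ : TotallyRamifiedFrom κ 0) (hK : ¬ 2 ∣ classNumber K)
    (he1 : 2 ≤ classNumberPExp κ 1) [NumberField (κ.layer 2)]
    (hs : {v : HeightOneSpectrum (𝓞 K) | v.asIdeal.ramificationIdxIn (𝓞 (κ.layer 2)) ≠ 1}.ncard = 2)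
    {u : (κ.layer 2)ˣ} (hu : u ∈ unitsE (κ.layer 2) ⊓ (unitsIncl K (κ.layer 2)).range)
    (hnot : u ∉ (⊤ : Subgroup (κ.layer 2)ˣ).map (Herbrand.norm ((κ.layer 2) ≃ₐ[K] (κ.layer 2)))) :
    (∀ m, classGroupPRank κ m ≤ 1) ∧ ClassicalMuVanishes κ ∧ classicalLambda κ ≤ 1 := by
  have hfix := not_four_dvd_card_fixed_layer_two_of_not_mem κ hκ hK hs hu hnot
  exact ⟨classGroupPRank_le_one_of_two_le_of_not_four_dvd κ hκ hK he1 hfix,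
    classicalMuVanishes_and_classicalLambda_le_one_of_two_le_of_not_four_dvd κ hκ hK he1 hfix⟩

end Chevalley

/-! ## §3 Odd degree, odd `e(w|2)`: Fukuda's index and the ramified set discharged -/

section OddDegree

variable {K : Type} [Field K] [NumberField K]

/-- **Exactly the dyadic primes ramify in `K_m`** (`m ≥ 1`) for a cyclotomic `ℤ₂`-extension of an odd-degree `K` all of whose dyadic primes have odd `e(w|2)`:
`#{v : e_v(K_m/K) ≠ 1} = #{w ∣ 2}` (tree `ncard_dyadic_le_ncard_ramified_layer` and `ncard_ramified_layer_le_of_ncard_eq`).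
[cite: Washington1997, §13.1 Prop. 13.2] [cite: NeukirchANT1999, Ch. III §2 Thm. (2.6)] -/
theorem ncard_ramified_layer_eq_ncard_dyadic (hK : ¬ 2 ∣ Module.finrank ℚ K) (κ : ZpExtension K 2) (hκ : κ.IsCyclotomic)
    (hodd : ∀ w : HeightOneSpectrum (𝓞 K), ((2 : ℕ) : 𝓞 K) ∈ w.asIdeal → Odd (w.asIdeal.ramificationIdx ℤ))
    {m : ℕ} (hm : 1 ≤ m) [NumberField (κ.layer m)] :
    {v : HeightOneSpectrum (𝓞 K) | v.asIdeal.ramificationIdxIn (𝓞 (κ.layer m)) ≠ 1}.ncard =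
      {w : HeightOneSpectrum (𝓞 K) | ((2 : ℕ) : 𝓞 K) ∈ w.asIdeal}.ncard :=
  le_antisymm (ncard_ramified_layer_le_of_ncard_eq κ m rfl) (ncard_dyadic_le_ncard_ramified_layer hK κ hκ hodd hm)

/-- ★★★ **THE PRO-CYCLIC DOOR for an odd-degree field whose dyadic primes have odd `e(w|2)`.**  `K` with `2 ∤ [K:ℚ]`, `κ` a cyclotomic `ℤ₂`-extension, every
`w ∣ 2` with `e(w|2)` odd, EXACTLY TWO primes of `K` above `2`, `2 ∤ h_K`, **`2 ≤ ord₂ h(K_1)`** and a unit `ε` of `𝓞 K` outside `N_{K_2/K} K_2ˣ`.  THEN `rank₂ Cl(K_m) ≤ 1`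
for every `m`, `μ₂(κ) = 0`, `λ₂(κ) ≤ 1`. [cite: Washington1997, §13.3 Prop. 13.22–13.23] [cite: Lang1990, Ch. 13 §4, Lemma 4.1 (PDF pp. 203–204)]
[cite: Fukuda1994, Thm. 1 (2), p. 264] -/
theorem classGroupPRank_le_one_of_two_le_of_not_mem_of_forall_odd_ramificationIdx (hK : ¬ 2 ∣ Module.finrank ℚ K)
    (κ : ZpExtension K 2) (hκ : κ.IsCyclotomic)
    (hodd : ∀ w : HeightOneSpectrum (𝓞 K), ((2 : ℕ) : 𝓞 K) ∈ w.asIdeal → Odd (w.asIdeal.ramificationIdx ℤ))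
    (h2 : {w : HeightOneSpectrum (𝓞 K) | ((2 : ℕ) : 𝓞 K) ∈ w.asIdeal}.ncard = 2)
    (hh : ¬ 2 ∣ classNumber K) (he1 : 2 ≤ classNumberPExp κ 1) [NumberField (κ.layer 2)] {ε : (𝓞 K)ˣ}
    (hnot : unitsIncl K (κ.layer 2) (Units.map (algebraMap (𝓞 K) K : 𝓞 K →* K) ε) ∉
      (⊤ : Subgroup (κ.layer 2)ˣ).map (Herbrand.norm ((κ.layer 2) ≃ₐ[K] (κ.layer 2)))) :
    (∀ m, classGroupPRank κ m ≤ 1) ∧ ClassicalMuVanishes κ ∧ classicalLambda κ ≤ 1 :=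
  classGroupPRank_le_one_of_two_le_of_not_mem κ (totallyRamifiedFrom_zero_of_forall_odd_ramificationIdx hK κ hκ hodd) hh he1
    (by rw [ncard_ramified_layer_eq_ncard_dyadic hK κ hκ hodd one_le_two, h2]) (unitsIncl_unitsMap_mem_unitsE_inf_range ε) hnot

/-- ★★★ **THE PRO-CYCLIC DOOR for an odd-degree field of odd discriminant** (`2 ∤ [K:ℚ]`, `2 ∤ d_K`, exactly two primes above `2`): `2 ∤ h_K`, `2 ≤ ord₂ h(K_1)` and
a unit `ε ∈ 𝓞_Kˣ` outside `N_{K_2/K} K_2ˣ` ⟹ `rank₂ Cl(K_m) ≤ 1 ∀ m`, `μ₂ = 0`, `λ₂ ≤ 1` for the cyclotomic `ℤ₂`-extension `κ`.  (Cubic `2`-torsion fields `ℚ(β)` with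
`Δ_W ≡ 5 (mod 8)`: `2 = 𝔭₁𝔭₂`; the class `t = 3 ∧ e_1 ≥ 2` of the cell's census.) [cite: Washington1997, §13.3 Prop. 13.22–13.23]
[cite: Lang1990, Ch. 13 §4, Lemma 4.1 (PDF pp. 203–204)] [cite: NeukirchANT1999, Ch. III (2.12)] [cite: Fukuda1994, Thm. 1 (2), p. 264] -/
theorem classGroupPRank_le_one_of_two_le_of_not_mem_of_not_dvd_discr (hK : ¬ 2 ∣ Module.finrank ℚ K)
    (hd : ¬ (2 : ℤ) ∣ NumberField.discr K) (κ : ZpExtension K 2) (hκ : κ.IsCyclotomic)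
    (h2 : {w : HeightOneSpectrum (𝓞 K) | ((2 : ℕ) : 𝓞 K) ∈ w.asIdeal}.ncard = 2)
    (hh : ¬ 2 ∣ classNumber K) (he1 : 2 ≤ classNumberPExp κ 1) [NumberField (κ.layer 2)] {ε : (𝓞 K)ˣ}
    (hnot : unitsIncl K (κ.layer 2) (Units.map (algebraMap (𝓞 K) K : 𝓞 K →* K) ε) ∉
      (⊤ : Subgroup (κ.layer 2)ˣ).map (Herbrand.norm ((κ.layer 2) ≃ₐ[K] (κ.layer 2)))) :
    (∀ m, classGroupPRank κ m ≤ 1) ∧ ClassicalMuVanishes κ ∧ classicalLambda κ ≤ 1 :=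
  classGroupPRank_le_one_of_two_le_of_not_mem_of_forall_odd_ramificationIdx hK κ hκ (forall_odd_ramificationIdx_of_not_dvd_discr hd)
    h2 hh he1 hnot

end OddDegree

end Literature.NumberTheory.IwasawaTheory

end
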